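import Mathlib
import Summits.QuantumFields.YangMills.Theses.MagneticFluxCeiling
import Summits.QuantumFields.YangMills.Theorems.ConvexGribovBodyNonSimplyConnectedLatticeGapStubTwistPlaneExchange

/-!
# `MagneticFluxCeiling.PlaneIndependence` — proof of the support item ⟨stmt-QuantumFields-25310⟩ of LINE g21-A (seat ym-idea-4)

Plane independence of the symmetric-torus twisted partition function is the tree theorem
`NonSimplyConnectedLatticeGap.twistedPartitionFunction_plane_independent` (hypercubic symmetry, every compact `G`);
the item exists only so that the route's assembly kernel-checks against built modules. [cite: Greensite2011, §4.4 (4.43)]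
-/

namespace Summit.QuantumFields.YangMills.Theorems.MagneticFluxCeiling

/-- ★ The support item `PlaneIndependence` of route `MagneticFluxCeiling`, by citation. -/
theorem planeIndependence_proof : Summit.QuantumFields.YangMills.Theses.MagneticFluxCeiling.PlaneIndependence :=
  fun _N r β z _n q q' =>
    Summit.QuantumFields.YangMills.Theorems.NonSimplyConnectedLatticeGap.twistedPartitionFunction_plane_independent
      r.ρ r.continuous β z q q'

end Summit.QuantumFields.YangMills.Theorems.MagneticFluxCeiling
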